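import Summits.FinalStateConjecture.FinalStateConjecture.Theorems.ExactKerrEndsTameEscapeGivenMassTheoremsOfStubs
import HarnessLib

/-!
# Route `ExactKerrEnds`, glue item `TameEscapeGivenMassTheorems` (stmt-FinalStateConjecture-18158):
# the minimal residual — the positive-mass branch of the crux

The glue item is `G := AdmissibleMassNonneg → ZeroMassAdmissibleMinkowskian → TameEscapeToKerrEnds`
(#6 → #7 → E). This file pins down, sorry-free and without any gluing-shaped hypothesis, exactly what
`G` asks beyond the two promoted mass items: the **positive-mass branch** `E⁺` of the crux
`E = TameEscapeToKerrEnds` (stmt-FinalStateConjecture-18522) — through every admissible datum that is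
NOT Kerr-ended and whose sole Dafermos–Rodnianski end has mass parameter `M > 0` passes a tame,
injective, immersed curve of admissible data whose members off `0` are Kerr-ended (stated with
`InitialDataSet.HasExactKerrEnd`, definitionally the let-bound legend `KerrEnded` of the route,
`InitialDataSet.hasExactKerrEnd_iff`).

* `tameEscapeGivenMassTheorems_of_posMassTameEscape` : `E⁺ → G` (the non-positive branch is #6 ∧ #7
  through the landed `nonposMassKerrEnded_of_massNonneg_of_zeroMassMinkowskian`; without
  `Kerr.Facts` every datum is vacuously Kerr-ended);
* `posMassTameEscape_of_tameEscapeToKerrEnds` : `E → E⁺` (restriction);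
* `tameEscapeGivenMassTheorems_of_tameEscapeToKerrEnds` : `E → G` (discard the hypotheses);
* `tameEscapeGivenMassTheorems_iff_posMassTameEscape` : given #6 and #7, `G ↔ E⁺`.

Together with the deciding theorem (`E := G #6 #7`) this records that, modulo the two mass items,
`G`, `E` and `E⁺` are equivalent: the glue item has no content of its own beyond the positive-mass
branch of the crux, whose every known proof is a receding exterior Kerr gluing (Corvino–Schoen 2006
Thm 4 / Chruściel–Delay 2003 Thm 8.1 / Mao–Oh–Tao 2023 Thm 1.3 + Lemma 4.2) run along a smooth
curve of radii with weighted `C² × C¹` control — the landed sufficient shapes S1 / S1♭ / S1♭♭ of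
`ExactKerrEndsTameEscapeGivenMassTheoremsOfStubs.lean` all imply `E⁺` (via `tameJunction`). `E⁺` is
the weakest statement a re-planned crux can carry so that the glue closes.

References: D. Christodoulou, CQG 16 (1999) A23, p. A24; J. Corvino, R. Schoen, J. Differential
Geom. 73 (2006), Thm 4; R. Beig, P. T. Chruściel, J. Math. Phys. 37 (1996), Thm 4.1.
-/

set_option linter.dupNamespace false

noncomputable section

namespace Summit.FinalStateConjecture.FinalStateConjecture.Theorems.ExactKerrEnds

open scoped Manifold ContDiff Topology
open Set Filter Function TopologicalSpace Literature.Geometry.Lorentzian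
open Summit.FinalStateConjecture.FinalStateConjecture.Theses.ExactKerrEnds
  (AdmissibleMassNonneg ZeroMassAdmissibleMinkowskian TameEscapeToKerrEnds TameEscapeGivenMassTheorems)

/-- **The glue item from the positive-mass branch `E⁺` of the crux.** If through every admissible,
non-Kerr-ended datum `d` with a sole Dafermos–Rodnianski end of mass parameter `M > 0` there passes a
tame, immersed, injective curve of admissible data through `d` whose members off `0` are Kerr-ended,
then `TameEscapeGivenMassTheorems` holds: fix `X` and an exceptional admissible `d`; without the
Kerr–Schild facts every datum is vacuously Kerr-ended; otherwise read off the sole DR end `(e, M)` of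
`d` — for `M ≤ 0` the two mass items make `d` Kerr-ended
(`nonposMassKerrEnded_of_massNonneg_of_zeroMassMinkowskian`), a contradiction, and for `M > 0` the
hypothesis is the witness. Christodoulou, CQG 16 (1999) A23, p. A24 (genericity through exceptional
data). [cite: Christodoulou1999, p. A24] -/
theorem tameEscapeGivenMassTheorems_of_posMassTameEscape
    (h : ∀ (X : Type) [TopologicalSpace X] [ChartedSpace E3 X] [IsManifold (𝓡 3) ∞ X] [T2Space X]
      [SecondCountableTopology X] [ConnectedSpace X], ∀ [Kerr.Facts],
      ∀ d ∈ admissibleVacuumData X, ∀ (e : AFEnd X) (M : ℝ), e.IsSoleEnd → 0 < M →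
        e.IsStronglyAsymptoticallyFlatDR d M → ¬ d.HasExactKerrEnd →
        ∃ (e' : AFEnd X) (F : EuclideanSpace ℝ (Fin 1) → InitialDataSet (𝓡 3) X),
          InitialDataSet.IsTameDataFamily e' 1 F ∧ InitialDataSet.IsImmersedAtZero 1 F ∧ F 0 = d ∧
            Injective F ∧ (∀ c, F c ∈ admissibleVacuumData X) ∧ ∀ c ≠ 0, (F c).HasExactKerrEnd) :
    TameEscapeGivenMassTheorems := by
  intro hP hZ X _ _ _ _ _ _
  -- the crux, with its let-bound legend `KerrEnded` zeta-reduced, is tame genericity of `HasExactKerrEnd`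
  show InitialDataSet.IsTameChristodoulouGeneric (admissibleVacuumData X)
    (fun D : InitialDataSet (𝓡 3) X ↦ D.HasExactKerrEnd) 1
  intro d hd
  obtain ⟨hd𝓓, hdexc⟩ := hd
  by_cases hKF : Kerr.Facts
  · obtain ⟨-, e, M, hsole, hDR⟩ := id hd𝓓
    by_cases hM : 0 < M
    · obtain ⟨e', F, htame, himm, hF0, hinj, hadm, hK⟩ := h X d hd𝓓 e M hsole hM hDR hdexc
      exact ⟨e', F, htame, himm, hF0, hinj, hadm, fun c hc hmem_exc ↦ hmem_exc.2 (hK c hc)⟩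
    · exact (hdexc (nonposMassKerrEnded_of_massNonneg_of_zeroMassMinkowskian hP hZ X d hd𝓓 e M
        hsole (not_lt.mp hM) hDR)).elim
  · exact absurd (fun hinst ↦ absurd hinst hKF) hdexc

/-- **The positive-mass branch `E⁺` from the crux `E` itself** (restriction of tame genericity of
Kerr-endedness to the exceptional data of positive mass parameter; the end, the mass and the decay
hypotheses are not used). Christodoulou, CQG 16 (1999) A23, p. A24. [cite: Christodoulou1999, p. A24] -/
theorem posMassTameEscape_of_tameEscapeToKerrEnds (hE : TameEscapeToKerrEnds) :
    ∀ (X : Type) [TopologicalSpace X] [ChartedSpace E3 X] [IsManifold (𝓡 3) ∞ X] [T2Space X]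
      [SecondCountableTopology X] [ConnectedSpace X], ∀ [Kerr.Facts],
      ∀ d ∈ admissibleVacuumData X, ∀ (e : AFEnd X) (M : ℝ), e.IsSoleEnd → 0 < M →
        e.IsStronglyAsymptoticallyFlatDR d M → ¬ d.HasExactKerrEnd →
        ∃ (e' : AFEnd X) (F : EuclideanSpace ℝ (Fin 1) → InitialDataSet (𝓡 3) X),
          InitialDataSet.IsTameDataFamily e' 1 F ∧ InitialDataSet.IsImmersedAtZero 1 F ∧ F 0 = d ∧
            Injective F ∧ (∀ c, F c ∈ admissibleVacuumData X) ∧ ∀ c ≠ 0, (F c).HasExactKerrEnd := by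
  intro X _ _ _ _ _ _ _ d hd _ _ _ _ _ hexc
  have hEX : InitialDataSet.IsTameChristodoulouGeneric (admissibleVacuumData X)
      (fun D : InitialDataSet (𝓡 3) X ↦ D.HasExactKerrEnd) 1 := hE X
  obtain ⟨e', F, htame, himm, hF0, hinj, hadm, hK⟩ := hEX d ⟨hd, hexc⟩
  refine ⟨e', F, htame, himm, hF0, hinj, hadm, fun c hc ↦ ?_⟩
  -- `F c ∉ {D ∈ 𝓓 | ¬ D.HasExactKerrEnd}` and `F c ∈ 𝓓`
  intro _
  by_contra hnot
  exact hK c hc ⟨hadm c, fun hKE ↦ hnot hKE⟩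

/-- **The glue item from the crux** (discard the two mass hypotheses): `E → G`. With the deciding
theorem's first line `E := G #6 #7` this makes `G` and `E` equivalent modulo the items
`AdmissibleMassNonneg`, `ZeroMassAdmissibleMinkowskian`. [folklore] -/
theorem tameEscapeGivenMassTheorems_of_tameEscapeToKerrEnds (hE : TameEscapeToKerrEnds) :
    TameEscapeGivenMassTheorems :=
  fun _ _ ↦ hE

/-- **Given the two mass items, the glue item IS the positive-mass branch of the crux**: under
`AdmissibleMassNonneg` (#6) and `ZeroMassAdmissibleMinkowskian` (#7),
`TameEscapeGivenMassTheorems ↔ E⁺`. Forward: `G #6 #7 = E`, then restrict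
(`posMassTameEscape_of_tameEscapeToKerrEnds`); backward:
`tameEscapeGivenMassTheorems_of_posMassTameEscape`. [folklore] -/
theorem tameEscapeGivenMassTheorems_iff_posMassTameEscape
    (hP : AdmissibleMassNonneg) (hZ : ZeroMassAdmissibleMinkowskian) :
    TameEscapeGivenMassTheorems ↔
      ∀ (X : Type) [TopologicalSpace X] [ChartedSpace E3 X] [IsManifold (𝓡 3) ∞ X] [T2Space X]
        [SecondCountableTopology X] [ConnectedSpace X], ∀ [Kerr.Facts],
        ∀ d ∈ admissibleVacuumData X, ∀ (e : AFEnd X) (M : ℝ), e.IsSoleEnd → 0 < M →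
          e.IsStronglyAsymptoticallyFlatDR d M → ¬ d.HasExactKerrEnd →
          ∃ (e' : AFEnd X) (F : EuclideanSpace ℝ (Fin 1) → InitialDataSet (𝓡 3) X),
            InitialDataSet.IsTameDataFamily e' 1 F ∧ InitialDataSet.IsImmersedAtZero 1 F ∧ F 0 = d ∧
              Injective F ∧ (∀ c, F c ∈ admissibleVacuumData X) ∧ ∀ c ≠ 0, (F c).HasExactKerrEnd :=
  ⟨fun hG ↦ posMassTameEscape_of_tameEscapeToKerrEnds (hG hP hZ),
    fun h ↦ tameEscapeGivenMassTheorems_of_posMassTameEscape h⟩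

end Summit.FinalStateConjecture.FinalStateConjecture.Theorems.ExactKerrEnds

end
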